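import Mathlib
import Summits.ValiantsHypothesis.ValiantsHypothesis.Theorems.NewtonUnitEquationsDissociatedUniformTotalsLawUnionCoSmall
import HarnessLib

/-!
# Crux `NewtonUnitEquations.DissociatedUniform` (stmt-ValiantsHypothesis-5905): the union totals law on the CONVEXLY ORDERED stratum

Companion of `…TotalsLawUnion` (the union-of-fibres totals law `UnionTotalsLaw C : ∑_s #vert conv U_s(Z) ≤ C·|G|²`, OPEN, shown there
to be the two-valued stratum of the `n = 3` totals law `TotalsLawThree`).  Memo `Cruxes/DissociatedUniform/NOTES-t1g4.md` §4
(R4′) located the first non-additive case: `G = ℤ/q`, `Z` an INTERVAL of positions, and §5 recorded that the census maximum of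
`UT/q²` (`1.40`) is attained by PAIRS OF CONVEX POLYGONS / PARABOLAS CARRYING THEIR NATURAL CYCLIC LABELLING with `Z` an interval.
This file proves the law — pointwise, with explicit constants — on exactly that stratum, for every position set `Z` at once:

* `CycUnimodal f` (`f : ZMod q → ℝ` weakly increases for `d` unit steps from some label and then weakly decreases around the rest
  of the cycle) and `ConvexlyOrdered a := ∀ w, CycUnimodal (x ↦ ⟨w, a x⟩)` — every linear functional is cyclically unimodal along
  the labelling, i.e. the curve `a : ℤ/q → ℝ²` runs through the vertices of a convex polygon IN CYCLIC ORDER (the (Q**) census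
  families "polygon pair", "parabola pair" with natural labels are of this kind).  `bdry Z` = the run endpoints of `Z`
  (positions `z ∈ Z` with `z + 1 ∉ Z` or `z - 1 ∉ Z`; `#bdry ≤ 2` for an interval, `card_bdry_interval_le_two`).
* THE WALK (`CycUnimodalAt.walk`): for cyclically unimodal `α, β` and any position set, from every pair `(x, y)` whose fibre
  `x + y` is present one can move by unit steps towards the two modes, never decreasing `α x + β y` and never leaving the present
  fibres except through a run endpoint.  Hence (`mem_fibre_or_top_of_isStrictTop`) a strict top of `U_s(Z)` in a direction `w`
  lies in a BOUNDARY FIBRE `P_{s-z}`, `z ∈ bdry Z`, or is the global top `a(m_α) + b(m_β)` of the whole pair sumset.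
* **`extremePoints_union_subset_of_convexlyOrdered`**: `vert conv U_s(Z) ⊆ vert conv (A + B) ∪ ⋃_{z ∈ bdry Z} vert conv P_{s-z}`
  (no general position: the exposing chart time is perturbed to a generic one, `exists_generic_isStrictTop`), so
  **`unionVert_le_of_convexlyOrdered`**: `#vert conv U_s(Z) ≤ 2q + ∑_{z ∈ bdry Z} V(P_{s-z})` POINTWISE, and
  **`unionTotal_le_of_convexlyOrdered`**: `unionTotal a b Z ≤ 2q² + #bdry Z · V_P ≤ (2 + #bdry Z)·q²`
  (the companion `…TotalsLawUnimodalClasses` specialises: interval `Z` ⇒ `≤ 4q²`, and the `n = 3` law for third curves with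
  boundedly many jumps on this stratum).
Honest label: a STRATUM theorem (both curves convexly ordered; constant linear in the number of runs of `Z`); `UnionTotalsLaw`,
`TotalsLawThree` remain OPEN (arbitrary labellings are the open case); nothing here bears on VP ≠ VNP.
[folklore: a linear functional restricted to the boundary cycle of a convex polygon is unimodal; the maximum of a unimodal sequence
over an interval is attained at an endpoint or at the mode]
-/

set_option linter.dupNamespace false -- `ValiantsHypothesis.ValiantsHypothesis` (summit = problem) in every name

open scoped BigOperators Pointwise

namespace Summit.ValiantsHypothesis.ValiantsHypothesis.Theorems.NewtonUnitEquationsDissociatedUniform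

namespace TotalsLaw

open Literature.Computability.AlgebraicComplexity.KPTT.PlanarMinkowski

/-! ### Cyclically unimodal sequences on `ZMod q` -/

section Unimodal

variable {q : ℕ} [NeZero q]

/-- `f` is cyclically unimodal WITH WITNESS `(n, d)`: along the labels `n, n+1, …` the values weakly increase for the first `d`
unit steps (up to the mode `n + d`) and weakly decrease for the remaining `q - 1 - d` steps. -/
def CycUnimodalAt (f : ZMod q → ℝ) (n : ZMod q) (d : ℕ) : Prop :=
  d < q ∧ (∀ k : ℕ, k < d → f (n + (k : ZMod q)) ≤ f (n + ((k + 1 : ℕ) : ZMod q))) ∧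
    ∀ k : ℕ, d ≤ k → k + 1 < q → f (n + ((k + 1 : ℕ) : ZMod q)) ≤ f (n + (k : ZMod q))

/-- `f : ZMod q → ℝ` is CYCLICALLY UNIMODAL: weakly increasing for some number of unit steps from some label, then weakly
decreasing around the rest of the cycle. -/
def CycUnimodal (f : ZMod q → ℝ) : Prop := ∃ (n : ZMod q) (d : ℕ), CycUnimodalAt f n d

/-- The number of unit steps from `x` to the mode `n + d` along the monotone arcs (`(x - n).val` is the position of `x` counted
from `n`). -/
def modeDist (n : ZMod q) (d : ℕ) (x : ZMod q) : ℕ :=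
  if (x - n).val ≤ d then d - (x - n).val else (x - n).val - d

/-- Every label is `n` plus its position. [folklore] -/
theorem eq_add_val (n x : ZMod q) : x = n + (((x - n).val : ℕ) : ZMod q) := by
  rw [ZMod.natCast_zmod_val]; abel

omit [NeZero q] in
/-- The position of `n + k` is `k` (`k < q`). [folklore] -/
theorem val_add_natCast_sub (n : ZMod q) {k : ℕ} (hk : k < q) : ((n + (k : ZMod q)) - n).val = k := by
  rw [add_sub_cancel_left, ZMod.val_cast_of_lt hk]

/-- `modeDist` vanishes exactly at the mode. [folklore] -/
theorem modeDist_eq_zero_iff {n : ZMod q} {d : ℕ} (hd : d < q) (x : ZMod q) : modeDist n d x = 0 ↔ x = n + (d : ZMod q) := by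
  constructor
  · intro h
    unfold modeDist at h
    split_ifs at h with hle
    · have hv : (x - n).val = d := le_antisymm hle (Nat.sub_eq_zero_iff_le.1 h)
      rw [eq_add_val n x, hv]
    · omega
  · rintro rfl
    unfold modeDist
    rw [val_add_natCast_sub n hd]
    simp

/-- **One step towards the mode.**  Off the mode there is a neighbouring label (`x + 1` on the ascending arc, `x - 1` on the
descending arc) with a value at least as large and strictly smaller `modeDist`. [folklore] -/
theorem CycUnimodalAt.step {f : ZMod q → ℝ} {n : ZMod q} {d : ℕ} (h : CycUnimodalAt f n d) {x : ZMod q}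
    (hx : modeDist n d x ≠ 0) :
    ∃ x' : ZMod q, (x' = x + 1 ∨ x' = x - 1) ∧ f x ≤ f x' ∧ modeDist n d x' < modeDist n d x := by
  obtain ⟨hd, hasc, hdesc⟩ := h
  set i := (x - n).val with hi
  have hiq : i < q := ZMod.val_lt _
  have hx_eq : x = n + (i : ZMod q) := eq_add_val n x
  by_cases hle : i ≤ d
  · -- ascending arc: move to `x + 1`
    have hlt : i < d := by
      refine lt_of_le_of_ne hle fun heq => hx ?_
      unfold modeDist
      rw [← hi, if_pos hle, heq, Nat.sub_self]
    have hx' : x + 1 = n + ((i + 1 : ℕ) : ZMod q) := by rw [hx_eq]; push_cast; ring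
    refine ⟨x + 1, Or.inl rfl, ?_, ?_⟩
    · rw [hx', hx_eq]; exact hasc i hlt
    · have hv : ((x + 1) - n).val = i + 1 := by rw [hx']; exact val_add_natCast_sub n (by omega)
      unfold modeDist
      rw [hv, ← hi, if_pos hle, if_pos (by omega)]
      omega
  · -- descending arc: move to `x - 1`
    push Not at hle
    have hi1 : 1 ≤ i := by omega
    have hx' : x - 1 = n + ((i - 1 : ℕ) : ZMod q) := by
      rw [hx_eq, Nat.cast_sub hi1]; push_cast; ring
    refine ⟨x - 1, Or.inr rfl, ?_, ?_⟩
    · have := hdesc (i - 1) (by omega) (by omega)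
      rw [show i - 1 + 1 = i by omega] at this
      rw [hx', hx_eq]; exact this
    · have hv : ((x - 1) - n).val = i - 1 := by rw [hx']; exact val_add_natCast_sub n (by omega)
      unfold modeDist
      rw [hv, ← hi, if_neg (not_le.2 hle)]
      split_ifs <;> omega

/-- **The mode carries the maximum.** [folklore] -/
theorem CycUnimodalAt.le_mode {f : ZMod q → ℝ} {n : ZMod q} {d : ℕ} (h : CycUnimodalAt f n d) (x : ZMod q) :
    f x ≤ f (n + (d : ZMod q)) := by
  suffices H : ∀ N x, modeDist n d x = N → f x ≤ f (n + (d : ZMod q)) from H _ x rfl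
  intro N
  induction N using Nat.strong_induction_on with
  | _ N ih =>
    intro x hx
    by_cases h0 : modeDist n d x = 0
    · rw [(modeDist_eq_zero_iff h.1 x).1 h0]
    · obtain ⟨x', -, hfx, hlt⟩ := h.step h0
      exact hfx.trans (ih _ (hx ▸ hlt) x' rfl)

/-- **The walk.**  Let `α, β` be cyclically unimodal with modes `m_α = n_α + d_α`, `m_β = n_β + d_β`, and let `W` be a set of
labels with a "boundary" `B` such that every non-boundary label of `W` has both neighbours in `W`.  From every pair `(x, y)` with
`x + y ∈ W` one reaches, without decreasing `α x + β y` and without leaving `W`, a pair whose sum is a boundary label or the pair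
of modes. [folklore: the maximum of a unimodal sequence over an interval is attained at an endpoint or at the mode] -/
theorem CycUnimodalAt.walk {α β : ZMod q → ℝ} {nα nβ : ZMod q} {dα dβ : ℕ} (hα : CycUnimodalAt α nα dα)
    (hβ : CycUnimodalAt β nβ dβ) (W B : Finset (ZMod q)) (hWB : ∀ r ∈ W, r ∉ B → r + 1 ∈ W ∧ r - 1 ∈ W)
    (x y : ZMod q) (hxy : x + y ∈ W) :
    ∃ x' y' : ZMod q, x' + y' ∈ W ∧ (x' + y' ∈ B ∨ (x' = nα + (dα : ZMod q) ∧ y' = nβ + (dβ : ZMod q))) ∧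
      α x + β y ≤ α x' + β y' := by
  suffices H : ∀ N (x y : ZMod q), modeDist nα dα x + modeDist nβ dβ y = N → x + y ∈ W →
      ∃ x' y' : ZMod q, x' + y' ∈ W ∧ (x' + y' ∈ B ∨ (x' = nα + (dα : ZMod q) ∧ y' = nβ + (dβ : ZMod q))) ∧
        α x + β y ≤ α x' + β y' from H _ x y rfl hxy
  intro N
  induction N using Nat.strong_induction_on with
  | _ N ih =>
    intro x y hN hW
    by_cases hB : x + y ∈ B
    · exact ⟨x, y, hW, Or.inl hB, le_rfl⟩
    obtain ⟨hup, hdown⟩ := hWB _ hW hB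
    by_cases hx0 : modeDist nα dα x = 0
    · by_cases hy0 : modeDist nβ dβ y = 0
      · exact ⟨x, y, hW, Or.inr ⟨(modeDist_eq_zero_iff hα.1 x).1 hx0, (modeDist_eq_zero_iff hβ.1 y).1 hy0⟩, le_rfl⟩
      · obtain ⟨y', hy'eq, hfy, hlt⟩ := hβ.step hy0
        have hW' : x + y' ∈ W := by
          rcases hy'eq with rfl | rfl
          · rw [show x + (y + 1) = x + y + 1 by ring]; exact hup
          · rw [show x + (y - 1) = x + y - 1 by ring]; exact hdown
        obtain ⟨x'', y'', h1, h2, h3⟩ := ih _ (by omega) x y' rfl hW'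
        exact ⟨x'', y'', h1, h2, by linarith⟩
    · obtain ⟨x', hx'eq, hfx, hlt⟩ := hα.step hx0
      have hW' : x' + y ∈ W := by
        rcases hx'eq with rfl | rfl
        · rw [show x + 1 + y = x + y + 1 by ring]; exact hup
        · rw [show x - 1 + y = x + y - 1 by ring]; exact hdown
      obtain ⟨x'', y'', h1, h2, h3⟩ := ih _ (by omega) x' y rfl hW'
      exact ⟨x'', y'', h1, h2, by linarith⟩

end Unimodal

/-! ### Convexly ordered curves and boundary fibres -/

section Convex

variable {q : ℕ} [NeZero q]

/-- The curve `a : ℤ/q → ℝ²` is CONVEXLY ORDERED: every linear functional `x ↦ ⟨w, a x⟩` is cyclically unimodal along the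
labelling (the labels run through the vertices of a convex polygon in cyclic order; collinear / repeated points allowed). -/
def ConvexlyOrdered (a : ZMod q → (Fin 2 → ℝ)) : Prop := ∀ w : Fin 2 → ℝ, CycUnimodal fun x => w ⬝ᵥ a x

/-- The RUN ENDPOINTS of a position set: positions `z ∈ Z` with `z + 1 ∉ Z` or `z - 1 ∉ Z`. -/
def bdry (Z : Finset (ZMod q)) : Finset (ZMod q) := Z.filter fun z => z + 1 ∉ Z ∨ z - 1 ∉ Z

omit [NeZero q] in
/-- Run endpoints are positions. [folklore] -/
theorem bdry_subset (Z : Finset (ZMod q)) : bdry Z ⊆ Z := Finset.filter_subset _ _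

omit [NeZero q] in
/-- A position that is not a run endpoint has both neighbours in `Z`. [folklore] -/
theorem neighbours_mem_of_not_mem_bdry {Z : Finset (ZMod q)} {z : ZMod q} (hz : z ∈ Z) (hb : z ∉ bdry Z) :
    z + 1 ∈ Z ∧ z - 1 ∈ Z := by
  by_contra h
  exact hb (Finset.mem_filter.2 ⟨hz, by tauto⟩)

variable (a b : ZMod q → (Fin 2 → ℝ))

/-- Finset model of the fibre `P_r`. -/
noncomputable def fibreFin (r : ZMod q) : Finset (Fin 2 → ℝ) := Finset.univ.image fun x : ZMod q => a x + b (r - x)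

/-- Its carrier is `P_r`. [folklore] -/
theorem coe_fibreFin (r : ZMod q) : (fibreFin a b r : Set (Fin 2 → ℝ)) = fibrePts a b r := by
  unfold fibreFin fibrePts
  rw [Finset.coe_image, Finset.coe_univ, Set.image_univ]

/-- A present fibre lies in the union. [folklore] -/
theorem fibreFin_subset_unionFin (Z : Finset (ZMod q)) {s z : ZMod q} (hz : z ∈ Z) :
    fibreFin a b (s - z) ⊆ unionFin a b (Z : Set (ZMod q)) s := by
  intro p hp
  obtain ⟨x, -, rfl⟩ := Finset.mem_image.1 hp
  rw [← Finset.mem_coe, coe_unionFin]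
  exact mem_unionPts.2 ⟨x, s - z - x, by rw [show s - x - (s - z - x) = z by abel]; exact hz, rfl⟩

/-- The carrier of `pairFin` is the pair sumset `A + B`. [folklore] -/
theorem coe_pairFin : (pairFin a b : Set (Fin 2 → ℝ)) = Set.range a + Set.range b := by
  ext p
  unfold pairFin
  rw [Finset.coe_image, Finset.coe_univ, Set.image_univ, Set.mem_range, Set.mem_add]
  constructor
  · rintro ⟨xy, rfl⟩
    exact ⟨a xy.1, ⟨xy.1, rfl⟩, b xy.2, ⟨xy.2, rfl⟩, rfl⟩
  · rintro ⟨_, ⟨x, rfl⟩, _, ⟨y, rfl⟩, rfl⟩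
    exact ⟨(x, y), rfl⟩

/-- **Boundary fibre or global top.**  If `⟨w, a ·⟩` and `⟨w, b ·⟩` are cyclically unimodal with modes `m_α`, `m_β`, then a strict
`w`-top of `U_s(Z)` is a strict `w`-top of a boundary fibre `P_{s-z}`, `z ∈ bdry Z`, or it is the point `a m_α + b m_β`, which
carries the maximum of `⟨w, ·⟩` over the whole pair sumset. [folklore] -/
theorem mem_fibre_or_top_of_isStrictTop {w : Fin 2 → ℝ} {nα nβ : ZMod q} {dα dβ : ℕ}
    (hα : CycUnimodalAt (fun x => w ⬝ᵥ a x) nα dα) (hβ : CycUnimodalAt (fun y => w ⬝ᵥ b y) nβ dβ)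
    (Z : Finset (ZMod q)) (s : ZMod q) {p : Fin 2 → ℝ} (htop : IsStrictTop w (unionFin a b (Z : Set (ZMod q)) s) p) :
    (∃ z ∈ bdry Z, IsStrictTop w (fibreFin a b (s - z)) p) ∨
      (p = a (nα + (dα : ZMod q)) + b (nβ + (dβ : ZMod q)) ∧ ∀ x y : ZMod q, w ⬝ᵥ (a x + b y) ≤ w ⬝ᵥ p) := by
  classical
  have hpU : p ∈ unionPts a b (Z : Set (ZMod q)) s := by rw [← coe_unionFin a b (Z : Set (ZMod q)) s]; exact htop.mem
  obtain ⟨x₀, y₀, hz₀, rfl⟩ := mem_unionPts.1 hpU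
  -- the present fibres and their run endpoints
  set W : Finset (ZMod q) := Finset.univ.filter fun r => s - r ∈ Z with hWdef
  set B : Finset (ZMod q) := Finset.univ.filter fun r => s - r ∈ bdry Z with hBdef
  have hWB : ∀ r ∈ W, r ∉ B → r + 1 ∈ W ∧ r - 1 ∈ W := by
    intro r hr hrB
    have hrZ : s - r ∈ Z := (Finset.mem_filter.1 hr).2
    have hrb : s - r ∉ bdry Z := fun h => hrB (Finset.mem_filter.2 ⟨Finset.mem_univ _, h⟩)
    obtain ⟨h1, h2⟩ := neighbours_mem_of_not_mem_bdry hrZ hrb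
    refine ⟨Finset.mem_filter.2 ⟨Finset.mem_univ _, ?_⟩, Finset.mem_filter.2 ⟨Finset.mem_univ _, ?_⟩⟩
    · rw [show s - (r + 1) = s - r - 1 by ring]; exact h2
    · rw [show s - (r - 1) = s - r + 1 by ring]; exact h1
  have hstart : x₀ + y₀ ∈ W :=
    Finset.mem_filter.2 ⟨Finset.mem_univ _, by rw [show s - (x₀ + y₀) = s - x₀ - y₀ by ring]; exact hz₀⟩
  obtain ⟨x', y', hW', hcase, hle⟩ := hα.walk hβ W B hWB x₀ y₀ hstart
  -- the end point of the walk is in the union, hence it is `p`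
  have hz' : s - x' - y' ∈ Z := by
    have := (Finset.mem_filter.1 hW').2
    rwa [show s - (x' + y') = s - x' - y' by ring] at this
  have hp'U : a x' + b y' ∈ unionFin a b (Z : Set (ZMod q)) s := by
    rw [← Finset.mem_coe, coe_unionFin]
    exact mem_unionPts.2 ⟨x', y', hz', rfl⟩
  have heq : a x' + b y' = a x₀ + b y₀ := by
    by_contra hne
    have h1 := htop.lt hp'U hne
    rw [dotProduct_add, dotProduct_add] at h1
    linarith
  rcases hcase with hB' | ⟨rfl, rfl⟩
  · left
    set z := s - (x' + y') with hzdef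
    have hzb : z ∈ bdry Z := (Finset.mem_filter.1 hB').2
    refine ⟨z, hzb, ?_, fun y hy hne => htop.lt (fibreFin_subset_unionFin a b Z (bdry_subset Z hzb) hy) hne⟩
    rw [← heq]
    exact Finset.mem_image.2 ⟨x', Finset.mem_univ _, by rw [show s - z - x' = y' by rw [hzdef]; ring]⟩
  · right
    refine ⟨heq.symm, fun x y => ?_⟩
    rw [← heq, dotProduct_add, dotProduct_add]
    exact add_le_add (hα.le_mode x) (hβ.le_mode y)

/-- **Vertices of a union are vertices of `A + B` or of a boundary fibre** (both curves convexly ordered; any position set; no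
general position). [folklore] -/
theorem extremePoints_union_subset_of_convexlyOrdered (ha : ConvexlyOrdered a) (hb : ConvexlyOrdered b)
    (Z : Finset (ZMod q)) (s : ZMod q) :
    (convexHull ℝ (unionPts a b (Z : Set (ZMod q)) s)).extremePoints ℝ ⊆
      (convexHull ℝ (Set.range a + Set.range b)).extremePoints ℝ ∪
        ⋃ z ∈ bdry Z, (convexHull ℝ (fibrePts a b (s - z))).extremePoints ℝ := by
  classical
  intro p hp
  rw [← coe_unionFin a b (Z : Set (ZMod q)) s] at hp
  -- expose `p` at a chart time generic for the pair sumset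
  obtain ⟨σ, t, -, hgen, -, htop⟩ := exists_generic_isStrictTop (unionFin a b (Z : Set (ZMod q)) s) (pairFin a b) (pairFin a b) hp
  obtain ⟨nα, dα, hα⟩ := ha ![σ, t]
  obtain ⟨nβ, dβ, hβ⟩ := hb ![σ, t]
  rcases mem_fibre_or_top_of_isStrictTop a b hα hβ Z s htop with ⟨z, hz, htopz⟩ | ⟨hpeq, hmax⟩
  · right
    rw [Set.mem_iUnion₂]
    refine ⟨z, hz, ?_⟩
    rw [← coe_fibreFin a b (s - z)]
    exact htopz.mem_extremePoints
  · left
    have hpS : p ∈ pairFin a b := Finset.mem_image.2 ⟨(nα + (dα : ZMod q), nβ + (dβ : ZMod q)), Finset.mem_univ _, hpeq.symm⟩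
    have hst : IsStrictTop ![σ, t] (pairFin a b) p := by
      refine ⟨hpS, fun y hy hne => lt_of_le_of_ne ?_ (hgen y hy p hpS hne)⟩
      obtain ⟨xy, -, rfl⟩ := Finset.mem_image.1 hy
      exact hmax xy.1 xy.2
    rw [← coe_pairFin a b]
    exact hst.mem_extremePoints

/-- The vertex count of the pair sumset is at most `2q` (planar Minkowski bound of the tree). [folklore] -/
theorem ncard_extremePoints_pairSum_le : ((convexHull ℝ (Set.range a + Set.range b)).extremePoints ℝ).ncard ≤ 2 * q := by
  have h := unionVert_univ_le a b 0
  unfold unionVert at h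
  rwa [unionPts_univ, ZMod.card] at h

/-- **The union totals law on the convexly ordered stratum, POINTWISE**: for both curves convexly ordered and ANY position set
`Z`, `#vert conv U_s(Z) ≤ 2q + ∑_{z ∈ bdry Z} V(P_{s-z})`. [folklore] -/
theorem unionVert_le_of_convexlyOrdered (ha : ConvexlyOrdered a) (hb : ConvexlyOrdered b) (Z : Finset (ZMod q)) (s : ZMod q) :
    unionVert a b (Z : Set (ZMod q)) s ≤ 2 * q + ∑ z ∈ bdry Z, fibreVert a b (s - z) := by
  have hfin : ((convexHull ℝ (Set.range a + Set.range b)).extremePoints ℝ ∪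
      ⋃ z ∈ bdry Z, (convexHull ℝ (fibrePts a b (s - z))).extremePoints ℝ).Finite := by
    refine Set.Finite.union ?_ (Set.Finite.biUnion (Finset.finite_toSet _) fun z _ => ?_)
    · exact ((Set.finite_range a).add (Set.finite_range b)).subset extremePoints_convexHull_subset
    · exact (Set.finite_range _).subset extremePoints_convexHull_subset
  unfold unionVert
  calc ((convexHull ℝ (unionPts a b (Z : Set (ZMod q)) s)).extremePoints ℝ).ncard
      ≤ ((convexHull ℝ (Set.range a + Set.range b)).extremePoints ℝ ∪
          ⋃ z ∈ bdry Z, (convexHull ℝ (fibrePts a b (s - z))).extremePoints ℝ).ncard :=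
        Set.ncard_le_ncard (extremePoints_union_subset_of_convexlyOrdered a b ha hb Z s) hfin
    _ ≤ ((convexHull ℝ (Set.range a + Set.range b)).extremePoints ℝ).ncard +
          (⋃ z ∈ bdry Z, (convexHull ℝ (fibrePts a b (s - z))).extremePoints ℝ).ncard := Set.ncard_union_le _ _
    _ ≤ 2 * q + ∑ z ∈ bdry Z, fibreVert a b (s - z) :=
        add_le_add (ncard_extremePoints_pairSum_le a b) (Finset.set_ncard_biUnion_le _ _)

/-- Hence `#vert conv U_s(Z) ≤ (2 + #bdry Z)·q` for every `s`. [folklore] -/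
theorem unionVert_le_of_convexlyOrdered' (ha : ConvexlyOrdered a) (hb : ConvexlyOrdered b) (Z : Finset (ZMod q)) (s : ZMod q) :
    unionVert a b (Z : Set (ZMod q)) s ≤ (2 + (bdry Z).card) * q := by
  calc unionVert a b (Z : Set (ZMod q)) s ≤ 2 * q + ∑ z ∈ bdry Z, fibreVert a b (s - z) :=
        unionVert_le_of_convexlyOrdered a b ha hb Z s
    _ ≤ 2 * q + ∑ _z ∈ bdry Z, q := by
        gcongr with z
        simpa [ZMod.card] using fibreVert_le_card a b (s - z)
    _ = (2 + (bdry Z).card) * q := by rw [Finset.sum_const, smul_eq_mul]; ring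

/-- **The union totals law on the convexly ordered stratum**: `unionTotal a b Z ≤ 2q² + #bdry Z · V_P` (`V_P = ∑_r V(P_r)` the
fibre total), for both curves convexly ordered and ANY position set `Z`. [folklore] -/
theorem unionTotal_le_of_convexlyOrdered (ha : ConvexlyOrdered a) (hb : ConvexlyOrdered b) (Z : Finset (ZMod q)) :
    unionTotal a b (Z : Set (ZMod q)) ≤ 2 * q ^ 2 + (bdry Z).card * fibreTotal a b := by
  unfold unionTotal
  calc ∑ s, unionVert a b (Z : Set (ZMod q)) s ≤ ∑ s, (2 * q + ∑ z ∈ bdry Z, fibreVert a b (s - z)) :=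
        Finset.sum_le_sum fun s _ => unionVert_le_of_convexlyOrdered a b ha hb Z s
    _ = 2 * q ^ 2 + ∑ z ∈ bdry Z, ∑ s, fibreVert a b (s - z) := by
        rw [Finset.sum_add_distrib, Finset.sum_const, Finset.card_univ, ZMod.card, smul_eq_mul, Finset.sum_comm]; ring
    _ = 2 * q ^ 2 + (bdry Z).card * fibreTotal a b := by
        have h : ∀ z ∈ bdry Z, ∑ s, fibreVert a b (s - z) = fibreTotal a b := fun z _ =>
          Equiv.sum_comp (Equiv.subRight z) (fibreVert a b)
        rw [Finset.sum_congr rfl h, Finset.sum_const, smul_eq_mul]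

/-- Hence `unionTotal a b Z ≤ (2 + #bdry Z)·q²`: the union totals law holds on this stratum with a constant linear in the number
of runs of `Z`. [folklore] -/
theorem unionTotal_le_of_convexlyOrdered' (ha : ConvexlyOrdered a) (hb : ConvexlyOrdered b) (Z : Finset (ZMod q)) :
    unionTotal a b (Z : Set (ZMod q)) ≤ (2 + (bdry Z).card) * q ^ 2 := by
  have h := fibreTotal_le_card_sq a b
  rw [ZMod.card] at h
  calc unionTotal a b (Z : Set (ZMod q)) ≤ 2 * q ^ 2 + (bdry Z).card * fibreTotal a b :=
        unionTotal_le_of_convexlyOrdered a b ha hb Z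
    _ ≤ 2 * q ^ 2 + (bdry Z).card * q ^ 2 := by gcongr
    _ = (2 + (bdry Z).card) * q ^ 2 := by ring

end Convex

end TotalsLaw

end Summit.ValiantsHypothesis.ValiantsHypothesis.Theorems.NewtonUnitEquationsDissociatedUniform
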